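import Literature.NumberTheory.Sieve.GoldbachLinnikDirectRoute
import Literature.NumberTheory.Sieve.GoldbachLinnikMajorArcWeightTransfer
import HarnessLib

/-!
# REVIEW-RUNBOOK sanity lemmas — the major-arc integrals of the Goldbach–Linnik closure are integrals of INTEGRABLE functions
# (client `pub-lg7` of the ops review-runbook generator; §2 cards `majorArcGoldbachIntegral`, `logMajorArcPairIntegral`)

Mathlib's Bochner integral `∫` returns the default `0` for a non-integrable integrand, so every identity or bound through
`majorArcGoldbachIntegral 𝔐 N n = Re ∫_{[0,1] ∩ 𝔐} A_N(α)² e(−nα) dα` (`GoldbachLinnikDirectRoute.lean`) and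
`logMajorArcPairIntegral 𝔐 N N₁ h = Re ∫_{[0,1] ∩ 𝔐} |S(α)|² e(hα) dα` (`GoldbachLinnikMajorArcWeightTransfer.lean`) silently
includes that case.  It does not occur: both integrands are trigonometric polynomials — finite exponential sums and their
squares / squared norms — hence CONTINUOUS, hence integrable on the bounded set `[0,1] ∩ 𝔐` for EVERY `𝔐`, `N`, `N₁`, `n`,
`h` (no measurability of `𝔐` needed: `IntegrableOn` on a subset of `[0,1]`).  Stated for the integrands exactly as the
definitions write them, so the runbooks' §2 cards read «SETTLED by kernel theorem» (review-runbook side-fact rows).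

Review evidence for the `pub-lg7` runbook, hosted in the nearest sub-problem's Theorems directory (`--supports`, helper;
closes nothing); no definitions, no `sorry`, standard axioms.
-/

namespace Summit.Parity.GeneralizedHardyLittlewood.Theorems.RunbookGoldbachLinnik

open scoped FourierTransform
open MeasureTheory Literature.NumberTheory.Sieve Literature.NumberTheory.Sieve.GoldbachLinnik

/-- `S(α) = Σ_{N₁ < p ≤ N} (log p) e(pα)` is continuous (a finite exponential sum). [folklore] -/
theorem continuous_logPrimeSumAbove (N N₁ : ℕ) : Continuous (logPrimeSumAbove N N₁) := by
  unfold logPrimeSumAbove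
  exact continuous_finsetSum _ fun _ _ => continuous_const.mul (GoldbachLinnik.continuous_fourierChar_mul _)

/-- The integrand of `majorArcGoldbachIntegral`, `α ↦ A_N(α)² · e(−nα)`, is continuous. [folklore] -/
theorem continuous_majorArcGoldbachIntegrand (N n : ℕ) :
    Continuous fun α : ℝ => oddPrimeLogSum N α ^ 2 * (𝐞 (-(n : ℝ) * α) : ℂ) :=
  ((continuous_oddPrimeLogSum N).pow 2).mul (GoldbachLinnik.continuous_fourierChar_mul _)

/-- **Side fact for the §2 card `majorArcGoldbachIntegral`**: its integrand is INTEGRABLE on `[0,1] ∩ 𝔐` for every set of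
arcs `𝔐` and all `N`, `n` — the `∫` is the integral, never the non-integrable default. [folklore] -/
theorem majorArcGoldbachIntegral_integrable (𝔐 : Set ℝ) (N n : ℕ) :
    IntegrableOn (fun α : ℝ => oddPrimeLogSum N α ^ 2 * (𝐞 (-(n : ℝ) * α) : ℂ)) (Set.Icc (0 : ℝ) 1 ∩ 𝔐) :=
  (continuous_majorArcGoldbachIntegrand N n).integrableOn_Icc.mono_set Set.inter_subset_left

/-- The integrand of `logMajorArcPairIntegral`, `α ↦ |S(α)|² · e(hα)`, is continuous. [folklore] -/
theorem continuous_logMajorArcPairIntegrand (N N₁ : ℕ) (h : ℤ) :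
    Continuous fun α : ℝ => ((‖logPrimeSumAbove N N₁ α‖ ^ 2 : ℝ) : ℂ) * (𝐞 ((h : ℝ) * α) : ℂ) :=
  (Complex.continuous_ofReal.comp ((continuous_norm.comp (continuous_logPrimeSumAbove N N₁)).pow 2)).mul
    (GoldbachLinnik.continuous_fourierChar_mul _)

/-- **Side fact for the §2 card `logMajorArcPairIntegral`**: its integrand is INTEGRABLE on `[0,1] ∩ 𝔐` for every `𝔐`, `N`,
`N₁`, `h`. [folklore] -/
theorem logMajorArcPairIntegral_integrable (𝔐 : Set ℝ) (N N₁ : ℕ) (h : ℤ) :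
    IntegrableOn (fun α : ℝ => ((‖logPrimeSumAbove N N₁ α‖ ^ 2 : ℝ) : ℂ) * (𝐞 ((h : ℝ) * α) : ℂ)) (Set.Icc (0 : ℝ) 1 ∩ 𝔐) :=
  (continuous_logMajorArcPairIntegrand N N₁ h).integrableOn_Icc.mono_set Set.inter_subset_left

end Summit.Parity.GeneralizedHardyLittlewood.Theorems.RunbookGoldbachLinnik
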